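import Mathlib
import HarnessLib

/-!
# Line `Sketch` (holomorphic coupling response) of crux `HypercubicLimit` — sign polarisation of multilinear maps

Support file for crux `stmt-QuantumFields-16154`, line `Sketch`, reshape 1: the algebra behind "ORDER ONE suffices".
For a multilinear map `f` in `n` arguments and vectors `v₁, …, v_n`,

  `∑_{ε ∈ {±1}ⁿ} (∏ᵢ εᵢ) • f(∑ⱼ εⱼ vⱼ, …, ∑ⱼ εⱼ vⱼ) = 2ⁿ • ∑_{σ ∈ Sym(n)} f(v_{σ 1}, …, v_{σ n})`

(`sum_sign_smul_map_diag_eq`): expanding the diagonal value multilinearly over all maps `σ : Fin n → Fin n`, the sign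
sum `∑_ε ∏ᵢ εᵢ ε_{σ i} = ∏ⱼ (1 + (−1)^{1 + #σ⁻¹(j)})` vanishes unless every fibre of `σ` is odd, in particular non-empty,
i.e. unless `σ` is a bijection, where it is `2ⁿ`.  For symmetric `f` the right side is `2ⁿ n! • f(v)`
(`sum_sign_smul_map_diag_eq_of_symmetric`).  Used by the line to recover every mixed truncated function from the
one-modulation responses (joint cumulants are multilinear and symmetric). [folklore]
-/

open Finset

namespace Summit.QuantumFields.YangMills.Cruxes.HypercubicLimit.CouplingResponse

section Polarisation

variable {R : Type*} [CommRing R] {M N : Type*} [AddCommGroup M] [Module R M] [AddCommGroup N] [Module R N]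
  {n : ℕ}

/-- `∑_{e ∈ {0,1}} ((−1)^e)^{c+1} = 2` if `c` is odd, `0` if `c` is even. [folklore] -/
theorem sum_signBit_pow_succ (c : ℕ) :
    ∑ e : Fin 2, ((-1 : R) ^ (e : ℕ)) ^ (c + 1) = if Odd c then 2 else 0 := by
  rw [Fin.sum_univ_two]
  simp only [Fin.val_zero, pow_zero, one_pow, Fin.val_one, pow_one]
  rcases Nat.even_or_odd c with hc | hc
  · rw [if_neg (Nat.not_odd_iff_even.2 hc), hc.add_one.neg_one_pow]; ring
  · rw [if_pos hc, hc.add_one.neg_one_pow]; ring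

/-- A self-map of `Fin n` all of whose fibres have odd cardinality is a bijection, and conversely. [folklore] -/
theorem forall_odd_card_fiber_iff_bijective (σ : Fin n → Fin n) :
    (∀ j, Odd (univ.filter fun i => σ i = j).card) ↔ Function.Bijective σ := by
  classical
  constructor
  · intro h
    have hsurj : Function.Surjective σ := fun j => by
      obtain ⟨m, hm⟩ := h j
      have hpos : 0 < (univ.filter fun i => σ i = j).card := by omega
      obtain ⟨i, hi⟩ := card_pos.1 hpos
      exact ⟨i, (mem_filter.1 hi).2⟩
    exact ⟨Finite.injective_iff_surjective.2 hsurj, hsurj⟩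
  · intro hσ j
    have h1 : (univ.filter fun i => σ i = j).card = 1 := by
      rw [card_eq_one]
      obtain ⟨i, hi⟩ := hσ.2 j
      refine ⟨i, ?_⟩
      ext i'
      simp only [mem_filter, mem_univ, true_and, mem_singleton]
      constructor
      · intro h'; exact hσ.1 (h'.trans hi.symm)
      · rintro rfl; exact hi
    rw [h1]
    exact odd_one

/-- **The sign sum over `{±1}ⁿ` attached to a self-map `σ`**: `∑_ε ∏ᵢ εᵢ ε_{σ i} = 2ⁿ` if `σ` is bijective and `0`
otherwise. [folklore] -/
theorem sum_prod_sign_mul_sign_comp (σ : Fin n → Fin n) :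
    ∑ ε : Fin n → Fin 2, ∏ i, ((-1 : R) ^ (ε i : ℕ)) * ((-1 : R) ^ (ε (σ i) : ℕ)) =
      if Function.Bijective σ then (2 : R) ^ n else 0 := by
  classical
  set c : Fin n → ℕ := fun j => (univ.filter fun i => σ i = j).card with hc
  -- the product over `i` as a product over `j` of powers
  have hprod : ∀ ε : Fin n → Fin 2,
      ∏ i, ((-1 : R) ^ (ε i : ℕ)) * ((-1 : R) ^ (ε (σ i) : ℕ)) = ∏ j, ((-1 : R) ^ (ε j : ℕ)) ^ (c j + 1) := by
    intro ε
    have h2 : ∏ i, ((-1 : R) ^ (ε (σ i) : ℕ)) = ∏ j, ((-1 : R) ^ (ε j : ℕ)) ^ c j := by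
      have := prod_comp (s := (univ : Finset (Fin n))) (fun j => (-1 : R) ^ (ε j : ℕ)) σ
      rw [this]
      refine prod_subset (subset_univ _) fun j _ hj => ?_
      have h0 : (univ.filter fun i => σ i = j) = ∅ := by
        rw [filter_eq_empty_iff]
        intro i _ hij
        exact hj (mem_image.2 ⟨i, mem_univ _, hij⟩)
      simp [h0]
    rw [prod_mul_distrib, h2, ← prod_mul_distrib]
    refine prod_congr rfl fun j _ => ?_
    ring
  simp_rw [hprod]
  -- interchange sum and product
  have hswap : ∑ ε : Fin n → Fin 2, ∏ j, ((-1 : R) ^ (ε j : ℕ)) ^ (c j + 1) =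
      ∏ j : Fin n, ∑ e : Fin 2, ((-1 : R) ^ (e : ℕ)) ^ (c j + 1) := by
    rw [prod_univ_sum]
    simp only [Fintype.piFinset_univ]
  rw [hswap]
  simp_rw [sum_signBit_pow_succ]
  by_cases hσ : Function.Bijective σ
  · rw [if_pos hσ]
    have hodd := (forall_odd_card_fiber_iff_bijective σ).2 hσ
    rw [prod_congr rfl fun j _ => if_pos (hodd j), prod_const, card_univ, Fintype.card_fin]
  · rw [if_neg hσ]
    have hnot : ¬ ∀ j, Odd (c j) := fun h => hσ ((forall_odd_card_fiber_iff_bijective σ).1 h)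
    push Not at hnot
    obtain ⟨j, hj⟩ := hnot
    exact prod_eq_zero (mem_univ j) (if_neg hj)

/-- **Sign polarisation of a multilinear map.**  For `f` multilinear in `n` arguments and `v : Fin n → M`,
`∑_{ε : Fin n → {0,1}} (∏ᵢ (−1)^{εᵢ}) • f (fun _ => ∑ⱼ (−1)^{εⱼ} • vⱼ) = 2ⁿ • ∑_{σ ∈ Perm (Fin n)} f (v ∘ σ)`. [folklore] -/
theorem sum_sign_smul_map_diag_eq :
    ∀ (R : Type*) [CommRing R] (M N : Type*) [AddCommGroup M] [Module R M] [AddCommGroup N] [Module R N] (n : ℕ) (f : MultilinearMap R (fun _ : Fin n => M) N) (v : Fin n → M), ∑ ε : Fin n → Fin 2, (∏ i, (-1 : R) ^ (ε i : ℕ)) • f (fun _ => ∑ j, (-1 : R) ^ (ε j : ℕ) • v j) = (2 : R) ^ n • ∑ σ : Equiv.Perm (Fin n), f (fun i => v (σ i)) := by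
  intro R _ M N _ _ _ _ n f v
  classical
  -- multilinear expansion of the diagonal value
  have hexp : ∀ ε : Fin n → Fin 2,
      f (fun _ => ∑ j, (-1 : R) ^ (ε j : ℕ) • v j) =
        ∑ σ : Fin n → Fin n, (∏ i, (-1 : R) ^ (ε (σ i) : ℕ)) • f (fun i => v (σ i)) := by
    intro ε
    have := f.map_sum (fun (_ : Fin n) (j : Fin n) => (-1 : R) ^ (ε j : ℕ) • v j)
    rw [this]
    refine sum_congr rfl fun σ _ => ?_
    exact f.map_smul_univ (fun i => (-1 : R) ^ (ε (σ i) : ℕ)) (fun i => v (σ i))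
  simp_rw [hexp, smul_sum, smul_smul, ← prod_mul_distrib]
  rw [sum_comm]
  simp_rw [← sum_smul, sum_prod_sign_mul_sign_comp, ite_smul, zero_smul]
  -- only bijections survive
  symm
  rw [← sum_filter]
  refine sum_bij (fun (e : Equiv.Perm (Fin n)) _ => (⇑e : Fin n → Fin n)) (fun e _ => ?_) (fun e₁ _ e₂ _ h => ?_)
    (fun σ hσ => ?_) (fun e _ => rfl)
  · exact mem_filter.2 ⟨mem_univ _, e.bijective⟩
  · exact Equiv.ext (congrFun h)
  · exact ⟨Equiv.ofBijective σ (mem_filter.1 hσ).2, mem_univ _, rfl⟩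

/-- **Sign polarisation, symmetric case**: if `f (v ∘ σ) = f v` for every permutation `σ`, then
`∑_ε (∏ᵢ (−1)^{εᵢ}) • f (∑ⱼ (−1)^{εⱼ} • vⱼ, …) = (2ⁿ n!) • f v`. [folklore] -/
theorem sum_sign_smul_map_diag_eq_of_symmetric (f : MultilinearMap R (fun _ : Fin n => M) N) (v : Fin n → M)
    (hsymm : ∀ σ : Equiv.Perm (Fin n), f (fun i => v (σ i)) = f v) :
    ∑ ε : Fin n → Fin 2, (∏ i, (-1 : R) ^ (ε i : ℕ)) • f (fun _ => ∑ j, (-1 : R) ^ (ε j : ℕ) • v j) =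
      ((2 : R) ^ n * n.factorial) • f v := by
  rw [sum_sign_smul_map_diag_eq R M N n f v]
  simp_rw [hsymm]
  rw [sum_const, card_univ, Fintype.card_perm, Fintype.card_fin, mul_smul, ← Nat.cast_smul_eq_nsmul R]

end Polarisation

end Summit.QuantumFields.YangMills.Cruxes.HypercubicLimit.CouplingResponse
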